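import Literature.NumberTheory.Automorphic.AdelicUnitaryGroupDatum
import Literature.NumberTheory.Automorphic.UnitaryGroupLocalCongr
import Literature.NumberTheory.Automorphic.UnitaryGroupFrameSubform
import Literature.NumberTheory.Automorphic.AutomorphicSpectrum
import HarnessLib

/-!
# Scale invariance of the unitary adelic group datum: `cmDatum L N (t • H) = cmDatum L N H` for `t ≠ 0`,
# and the transport of datum-level statements (multiplicity one, automorphic measures, …) along it

Topic `NumberTheory/Automorphic`; namespace `Literature.NumberTheory.Automorphic` (grouping sub-namespace `UnitaryGroup`,
continued from `AdelicUnitaryGroupDatum`).  PROOF FILE: theorems only — no definition, no instance, no notation, no named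
fact, no `sorry`; imports = tree + `HarnessLib`.  Cell `hodgecm-mathlib`, floor 0, programme P5 (crux `HLiu418`,
`Cruxes/HLiu418/Lines/F0_AlbCm.lean` ED. 10, junction J₂ + adapter A₂ of the ED. 11 socket spec
`F0/P5/p02/ED11/SPEC-ED11-sockets.v1`); author F0P5-p03 (g3).  HC_CM is proved only modulo the printed citations until
rung 0 closes; this file discharges none of them (count-neutral kernel glue).

WHY.  The P5 letters (★ `Rogawski1990.curveMultiplicityLeOne`, ★ `Rogawski1990.curveThetaCohFinComponentUnique_hol`, …)
quantify over a matrix `H ∈ M₂(L)` together with a frame `formCongr c g (t • H) = diagonal dV` (`t ∈ L`, `t ≠ 0`, `dV` real):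
it is `t • H`, not `H`, that is visibly `c`-hermitian with unit determinant, while the automorphic objects (`DiscreteAutomorphicRep`,
`rightRegular μ`, `multiplicity`) are typed over the datum of `H`.  An engine typed, as the T1 line is, over a hermitian matrix
(`(H.map (cmConjRingHom L))ᵀ = H`, `IsUnit H.det`) therefore proves its statements for the datum of `t • H`; this file moves them
to the datum of `H`.  The unitary GROUPS of `t • H` and `H` coincide as subgroups (★ `unitaryGroupOfForm_smul_of_isUnit`,
★ `UnitaryGroup.rational_smul`, ★ `UnitaryGroup.finAdelic_smul`, ★ `UnitaryGroup.local_smul`); here the whole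
`AdelicGroupData` STRUCTURE is shown to coincide (`cmDatum_smul`), so that every statement phrased over the datum transports by
`Eq.rec` — no isomorphism bookkeeping is needed.

CONTENTS.
* §1 `unitaryGroup_cmConjRingHom_smul`, `adelicUnitaryGroup_smul`, **`cmDatum_smul`** (`t ≠ 0 → cmDatum L N (t • H) = cmDatum L N H`,
  an equality of `AdelicGroupData L⁺`), `adelicGroupData_cm_smul` (the generic spelling `UnitaryGroup.adelicGroupData L⁺ L c N H`).
* §2 transports: `forall_multiplicity_le_one_of_smul` ∕ `…_iff_smul` («every discrete automorphic `P` of `U(t • H)` has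
  multiplicity `≤ 1` in `L²`» ⇔ the same for `U(H)`, every `N`), the socket text J₂ of the spec VERBATIM at `N = 2`
  (`j2_scaleTransport`), and the generic-spelling form used by the curve* letters.
* §3 the frame adapter A₂: from `formCongr c g (t • H) = diagonal dV` with `c (dV i) = dV i` (and `dV i ≠ 0`):
  `((t • H).map (cmConjRingHom L))ᵀ = t • H` and `IsUnit (t • H).det` — the two hypotheses a hermitian-typed engine asks for.

References: [PlatonovRapinchuk1994] V. Platonov, A. Rapinchuk, *Algebraic Groups and Number Theory* (1994), §2.3 (unitary groups of
hermitian forms depend only on the similarity class of the form).  [Dieudonne1971GroupesClassiques] J. Dieudonné, *La géométrie des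
groupes classiques* (1971), Chap. II §5.  [Mok2014] C. P. Mok, Mem. AMS 235 (2015), §1 Notation p. 5 (the groups `U(J)`).
-/

set_option autoImplicit false

noncomputable section

open NumberField IsDedekindDomain MeasureTheory
open scoped Matrix

namespace Literature.NumberTheory.Automorphic

open Literature.AlgebraicGeometry.ShimuraVarieties (unitaryGroup)

/-! ## §0 Plumbing: heterogeneous equality of co-restricted restrictions -/

section Plumbing

/-- Two co-restricted restrictions `(φ|_{S}) : S →* T` of the same homomorphism `φ` along EQUAL subgroups `S₁ = S₂`, `T₁ = T₂`
are heterogeneously equal (the membership proofs are irrelevant). [folklore] -/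
private theorem heq_codRestrict_restrict {A B : Type*} [Group A] [Group B] (φ : A →* B)
    {S₁ S₂ : Subgroup A} {T₁ T₂ : Subgroup B} (hS : S₁ = S₂) (hT : T₁ = T₂)
    (p₁ : ∀ g : S₁, φ.restrict S₁ g ∈ T₁) (p₂ : ∀ g : S₂, φ.restrict S₂ g ∈ T₂) :
    HEq ((φ.restrict S₁).codRestrict T₁ p₁) ((φ.restrict S₂).codRestrict T₂ p₂) := by
  subst hS hT
  rfl

end Plumbing

namespace UnitaryGroup

variable (L : Type) [Field L] [NumberField L] [IsCMField L] (N : ℕ)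

/-! ## §1 The datum of `t • H` IS the datum of `H` -/

/-- `U(t • H)(L⁺) = U(H)(L⁺)` as subgroups of `GL_N(L)` for `t ≠ 0` (★ `rational_smul` read through ★ `rational_complexConj`).
[cite: PlatonovRapinchuk1994, §2.3] -/
theorem unitaryGroup_cmConjRingHom_smul {t : L} (ht : t ≠ 0) (H : Matrix (Fin N) (Fin N) L) :
    unitaryGroup (cmConjRingHom L) (t • H) = unitaryGroup (cmConjRingHom L) H := by
  rw [← rational_complexConj, ← rational_complexConj]
  exact rational_smul (↥(maximalRealSubfield L)) L (IsCMField.complexConj L) N ht H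

omit [IsCMField L] in
/-- `(t • H)_𝔸 = t_𝔸 • H_𝔸` (the form read over the adeles; plumbing). [folklore] -/
private theorem map_smul_algebraMap_adeleRing (t : L) (H : Matrix (Fin N) (Fin N) L) :
    (t • H).map (algebraMap L (AdeleRing (𝓞 L) L)) =
      algebraMap L (AdeleRing (𝓞 L) L) t • H.map (algebraMap L (AdeleRing (𝓞 L) L)) := by
  ext i j
  simp [Matrix.map_apply, Matrix.smul_apply, smul_eq_mul, map_mul]

/-- `U(t • H)(𝔸_{L⁺}) = U(H)(𝔸_{L⁺})` as subgroups of `GL_N(𝔸_L)` for `t ≠ 0`. [cite: PlatonovRapinchuk1994, §2.3] -/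
theorem adelicUnitaryGroup_smul {t : L} (ht : t ≠ 0) (H : Matrix (Fin N) (Fin N) L) :
    adelicUnitaryGroup L (t • H) = adelicUnitaryGroup L H := by
  rw [← adelic_complexConj, ← adelic_complexConj]
  change unitaryGroupOfForm _ (adelicForm L N (t • H)) = unitaryGroupOfForm _ (adelicForm L N H)
  rw [adelicForm_eq_map, adelicForm_eq_map, map_smul_algebraMap_adeleRing]
  exact unitaryGroupOfForm_smul_of_isUnit _ ((IsUnit.mk0 t ht).map _) _

/-- `U(t • H)(L⁺_v) = U(H)(L⁺_v)` at every finite place `v` of `L⁺`, as a family (★ `local_smul`). [cite: PlatonovRapinchuk1994, §2.3] -/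
theorem local_cm_smul {t : L} (ht : t ≠ 0) (H : Matrix (Fin N) (Fin N) L) :
    «local» L (IsCMField.complexConj L) N (t • H) = «local» L (IsCMField.complexConj L) N H :=
  funext fun v => local_smul L (IsCMField.complexConj L) ht H v

/-- **Scale invariance of the datum**: for `t ≠ 0` the adelic group datum of `U(t • H)` IS that of `U(H)` — an equality of
`AdelicGroupData L⁺` structures (rational, adelic and local groups, their topologies, the diagonal and local maps, `A_G = 1`), not
merely of the underlying groups.  Consequently every statement typed over the datum (automorphic quotient, automorphic measures,
`L²`, discrete automorphic representations, multiplicities) transports along it by `Eq.rec`. [cite: PlatonovRapinchuk1994, §2.3]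
[cite: Mok2014, §1 Notation p. 5] -/
theorem cmDatum_smul {t : L} (ht : t ≠ 0) (H : Matrix (Fin N) (Fin N) L) :
    cmDatum L N (t • H) = cmDatum L N H := by
  have h1 := unitaryGroup_cmConjRingHom_smul L N ht H
  have h2 := adelicUnitaryGroup_smul L N ht H
  have h3 := local_cm_smul L N ht H
  unfold cmDatum
  congr 1
  · rw [h1]
  · rw [h2]
  · rw [h1]
  · rw [h2]
  · rw [h2]
  · exact proof_irrel_heq _ _
  · exact heq_codRestrict_restrict (toAdeleGL L) h1 h2 _ _
  · rw [h3]
  · rw [h3]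
  · rw [h3]
  · exact proof_irrel_heq _ _
  · refine Function.hfunext rfl fun v v' hvv' => ?_
    cases hvv'
    exact heq_codRestrict_restrict (Matrix.GeneralLinearGroup.map (adeleToLocal L v)) h2 (congrFun h3 v) _ _
  · exact proof_irrel_heq _ _
  · rw [h2]
  · exact proof_irrel_heq _ _

/-- The same for the tree's generic spelling `UnitaryGroup.adelicGroupData L⁺ L c N H` of the datum (★ `adelicGroupData_eq_cmDatum` is
`rfl`), the spelling of the P5 letters. [cite: PlatonovRapinchuk1994, §2.3] -/
theorem adelicGroupData_cm_smul {t : L} (ht : t ≠ 0) (H : Matrix (Fin N) (Fin N) L) :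
    adelicGroupData (↥(maximalRealSubfield L)) L (IsCMField.complexConj L) N (t • H) =
      adelicGroupData (↥(maximalRealSubfield L)) L (IsCMField.complexConj L) N H :=
  cmDatum_smul L N ht H

/-! ## §2 Transport of multiplicity one along the scaling -/

/-- **Multiplicity one descends from `U(t • H)` to `U(H)`** (every `N`, `t ≠ 0`): if every discrete automorphic representation of the
datum `cmDatum L N (t • H)` occurs in `L²` with multiplicity `≤ 1` (for every automorphic measure), then so does every discrete
automorphic representation of `cmDatum L N H`.  Pure transport along `cmDatum_smul`. [cite: PlatonovRapinchuk1994, §2.3] -/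
theorem forall_multiplicity_le_one_of_smul {t : L} (ht : t ≠ 0) (H : Matrix (Fin N) (Fin N) L)
    (h : ∀ (μ' : Measure (cmDatum L N (t • H)).automorphicQuotient) [(cmDatum L N (t • H)).IsAutomorphicMeasure μ']
      (P' : DiscreteAutomorphicRep (cmDatum L N (t • H)) μ'),
      ((cmDatum L N (t • H)).rightRegular μ').multiplicity P'.space.toContRep ≤ 1)
    (μ : Measure (cmDatum L N H).automorphicQuotient) [(cmDatum L N H).IsAutomorphicMeasure μ]
    (P : DiscreteAutomorphicRep (cmDatum L N H) μ) :
    ((cmDatum L N H).rightRegular μ).multiplicity P.space.toContRep ≤ 1 := by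
  have key : ∀ 𝒢 : AdelicGroupData ↥(maximalRealSubfield L), 𝒢 = cmDatum L N (t • H) →
      ∀ (ν : Measure 𝒢.automorphicQuotient) [𝒢.IsAutomorphicMeasure ν] (Q : DiscreteAutomorphicRep 𝒢 ν),
        (𝒢.rightRegular ν).multiplicity Q.space.toContRep ≤ 1 := by
    rintro 𝒢 rfl
    exact h
  exact key (cmDatum L N H) (cmDatum_smul L N ht H).symm μ P

/-- **Multiplicity one is scale-invariant** (every `N`, `t ≠ 0`): «every discrete automorphic `P` of `U(t • H)` has multiplicity `≤ 1`
in `L²`» ⇔ «every discrete automorphic `P` of `U(H)` has multiplicity `≤ 1` in `L²`». [cite: PlatonovRapinchuk1994, §2.3] -/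
theorem forall_multiplicity_le_one_smul_iff {t : L} (ht : t ≠ 0) (H : Matrix (Fin N) (Fin N) L) :
    (∀ (μ' : Measure (cmDatum L N (t • H)).automorphicQuotient) [(cmDatum L N (t • H)).IsAutomorphicMeasure μ']
      (P' : DiscreteAutomorphicRep (cmDatum L N (t • H)) μ'),
      ((cmDatum L N (t • H)).rightRegular μ').multiplicity P'.space.toContRep ≤ 1) ↔
    (∀ (μ : Measure (cmDatum L N H).automorphicQuotient) [(cmDatum L N H).IsAutomorphicMeasure μ]
      (P : DiscreteAutomorphicRep (cmDatum L N H) μ),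
      ((cmDatum L N H).rightRegular μ).multiplicity P.space.toContRep ≤ 1) := by
  refine ⟨fun h μ _ P => forall_multiplicity_le_one_of_smul L N ht H h μ P, fun h μ' _ P' => ?_⟩
  have ht' : t⁻¹ ≠ 0 := inv_ne_zero ht
  have hH : t⁻¹ • (t • H) = H := by rw [smul_smul, inv_mul_cancel₀ ht, one_smul]
  have h' : ∀ (μ : Measure (cmDatum L N (t⁻¹ • (t • H))).automorphicQuotient)
      [(cmDatum L N (t⁻¹ • (t • H))).IsAutomorphicMeasure μ] (P : DiscreteAutomorphicRep (cmDatum L N (t⁻¹ • (t • H))) μ),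
      ((cmDatum L N (t⁻¹ • (t • H))).rightRegular μ).multiplicity P.space.toContRep ≤ 1 := by
    rw [hH]
    exact h
  exact forall_multiplicity_le_one_of_smul L N ht' (t • H) h' μ' P'

/-- **JUNCTION J₂ of the ED. 11 socket spec, VERBATIM** (`F0/P5/p02/ED11/SPEC-ED11-sockets.v1`, text `J2_ScaleTransport`, `N = 2`): multiplicity
one for the datum `cmDatum L 2 (t • H)` gives multiplicity one for `cmDatum L 2 H`. [cite: PlatonovRapinchuk1994, §2.3] -/
theorem j2_scaleTransport :
    ∀ (L : Type) [Field L] [NumberField L] [IsCMField L] (H : Matrix (Fin 2) (Fin 2) L) (t : L), t ≠ 0 →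
    (∀ (μ' : Measure (cmDatum L 2 (t • H)).automorphicQuotient) [(cmDatum L 2 (t • H)).IsAutomorphicMeasure μ']
      (P' : DiscreteAutomorphicRep (cmDatum L 2 (t • H)) μ'),
      ((cmDatum L 2 (t • H)).rightRegular μ').multiplicity P'.space.toContRep ≤ 1) →
    ∀ (μ : Measure (cmDatum L 2 H).automorphicQuotient) [(cmDatum L 2 H).IsAutomorphicMeasure μ]
      (P : DiscreteAutomorphicRep (cmDatum L 2 H) μ),
      ((cmDatum L 2 H).rightRegular μ).multiplicity P.space.toContRep ≤ 1 :=
  fun L _ _ _ H _t ht h μ _ P => forall_multiplicity_le_one_of_smul L 2 ht H h μ P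

/-- The transport in the GENERIC spelling `UnitaryGroup.adelicGroupData L⁺ L c N H` of the curve* letters (★ `Rogawski1990.curveMultiplicityLeOne`
quantifies over this datum): multiplicity one for the datum of `t • H` gives multiplicity one for the datum of `H`. [cite: PlatonovRapinchuk1994, §2.3] -/
theorem forall_multiplicity_le_one_adelicGroupData_of_smul {t : L} (ht : t ≠ 0) (H : Matrix (Fin N) (Fin N) L)
    (h : ∀ (μ' : Measure (adelicGroupData (↥(maximalRealSubfield L)) L (IsCMField.complexConj L) N (t • H)).automorphicQuotient)
      [(adelicGroupData (↥(maximalRealSubfield L)) L (IsCMField.complexConj L) N (t • H)).IsAutomorphicMeasure μ']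
      (P' : DiscreteAutomorphicRep (adelicGroupData (↥(maximalRealSubfield L)) L (IsCMField.complexConj L) N (t • H)) μ'),
      ((adelicGroupData (↥(maximalRealSubfield L)) L (IsCMField.complexConj L) N (t • H)).rightRegular μ').multiplicity
        P'.space.toContRep ≤ 1)
    (μ : Measure (adelicGroupData (↥(maximalRealSubfield L)) L (IsCMField.complexConj L) N H).automorphicQuotient)
    [(adelicGroupData (↥(maximalRealSubfield L)) L (IsCMField.complexConj L) N H).IsAutomorphicMeasure μ]
    (P : DiscreteAutomorphicRep (adelicGroupData (↥(maximalRealSubfield L)) L (IsCMField.complexConj L) N H) μ) :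
    ((adelicGroupData (↥(maximalRealSubfield L)) L (IsCMField.complexConj L) N H).rightRegular μ).multiplicity
      P.space.toContRep ≤ 1 :=
  -- ★ `adelicGroupData_eq_cmDatum` is `rfl`, but instance search does not unfold it: hand the instance over as a term
  @forall_multiplicity_le_one_of_smul L _ _ _ N t ht H h μ
    ‹(adelicGroupData (↥(maximalRealSubfield L)) L (IsCMField.complexConj L) N H).IsAutomorphicMeasure μ› P

/-! ## §3 The frame adapter A₂: `t • H` is hermitian with unit determinant -/

/-- The two spellings of complex conjugation as a ring endomorphism of `L` agree: the coercion of Mathlib's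
`IsCMField.complexConj L : L ≃ₐ[L⁺] L` (used by the curve* letters) and ★ `cmConjRingHom L` (used by the T1 engine); plumbing. [folklore] -/
private theorem ringHom_complexConj_eq_cmConjRingHom :
    ((IsCMField.complexConj L : L ≃ₐ[↥(maximalRealSubfield L)] L) : L →+* L) = cmConjRingHom L :=
  RingHom.ext fun _ => rfl

/-- **A₂ (hermitian symmetry from the frame)**: if `ᵗ(c g) · (t • H) · g = diagonal dV` with `c (dV i) = dV i` for all `i`, then `t • H` is
`c`-hermitian: `((t • H).map c)ᵀ = t • H` — because `t • H = ᵗ(c g⁻¹) · diagonal dV · g⁻¹` (★ `formCongr_inv_formCongr`) and the frame transform of a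
`c`-hermitian matrix is `c`-hermitian (★ `transpose_map_formCongr`, `c ∘ c = id`).  Stated with the T1 engine's spelling `cmConjRingHom L` of `c`
in the conclusion and the letters' spelling in the hypothesis. [cite: Dieudonne1971GroupesClassiques, Chap. II §5] -/
theorem conjTranspose_smul_eq_of_formCongr_eq_diagonal (H : Matrix (Fin N) (Fin N) L) (dV : Fin N → L)
    (hdV : ∀ i, IsCMField.complexConj L (dV i) = dV i) (t : L) (g : GL (Fin N) L)
    (hg : formCongr ((IsCMField.complexConj L : L ≃ₐ[↥(maximalRealSubfield L)] L) : L →+* L) g (t • H) = Matrix.diagonal dV) :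
    ((t • H).map (cmConjRingHom L))ᵀ = t • H := by
  rw [ringHom_complexConj_eq_cmConjRingHom] at hg
  have hcc : ∀ x : L, cmConjRingHom L (cmConjRingHom L x) = x := fun x => by
    rw [cmConjRingHom_apply, cmConjRingHom_apply, IsCMField.complexConj_apply_apply]
  have hM : t • H = formCongr (cmConjRingHom L) g⁻¹ (Matrix.diagonal dV) := by
    rw [← hg, formCongr_inv_formCongr]
  have hD : ((Matrix.diagonal dV).map (cmConjRingHom L))ᵀ = Matrix.diagonal dV := by
    rw [Matrix.diagonal_map (map_zero _), Matrix.diagonal_transpose]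
    congr 1
    funext i
    exact hdV i
  rw [hM, transpose_map_formCongr (cmConjRingHom L) hcc, hD]

/-- **A₂ (unit determinant from the frame)**: if `ᵗ(c g) · (t • H) · g = diagonal dV` with all `dV i ≠ 0`, then `det (t • H)` is a unit.
(★ `det_formCongr`: `det (diagonal dV) = c (det g) · det (t • H) · det g`.) [cite: Dieudonne1971GroupesClassiques, Chap. II §5] -/
theorem isUnit_det_smul_of_formCongr_eq_diagonal (H : Matrix (Fin N) (Fin N) L) (dV : Fin N → L)
    (hdV0 : ∀ i, dV i ≠ 0) (t : L) (g : GL (Fin N) L)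
    (hg : formCongr ((IsCMField.complexConj L : L ≃ₐ[↥(maximalRealSubfield L)] L) : L →+* L) g (t • H) = Matrix.diagonal dV) :
    IsUnit (t • H).det := by
  rw [isUnit_iff_ne_zero]
  intro h0
  have hdet := congrArg Matrix.det hg
  rw [det_formCongr, h0, mul_zero, zero_mul, Matrix.det_diagonal] at hdet
  exact (Finset.prod_ne_zero_iff.mpr fun i _ => hdV0 i) hdet.symm

/-- **A₂ packaged with J₀**: under the frame hypothesis of the curve* letters, the matrix `t • H` satisfies the T1 engine's hypothesis pair
«`c`-hermitian with unit determinant», and its datum is the letters' datum: `cmDatum L N (t • H) = adelicGroupData L⁺ L c N H`.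
[cite: PlatonovRapinchuk1994, §2.3] [cite: Dieudonne1971GroupesClassiques, Chap. II §5] -/
theorem frame_adapter (H : Matrix (Fin N) (Fin N) L) (dV : Fin N → L)
    (hdV : ∀ i, IsCMField.complexConj L (dV i) = dV i) (hdV0 : ∀ i, dV i ≠ 0) (t : L) (ht : t ≠ 0) (g : GL (Fin N) L)
    (hg : formCongr ((IsCMField.complexConj L : L ≃ₐ[↥(maximalRealSubfield L)] L) : L →+* L) g (t • H) = Matrix.diagonal dV) :
    ((t • H).map (cmConjRingHom L))ᵀ = t • H ∧ IsUnit (t • H).det ∧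
      cmDatum L N (t • H) = adelicGroupData (↥(maximalRealSubfield L)) L (IsCMField.complexConj L) N H :=
  ⟨conjTranspose_smul_eq_of_formCongr_eq_diagonal L N H dV hdV t g hg,
    isUnit_det_smul_of_formCongr_eq_diagonal L N H dV hdV0 t g hg, cmDatum_smul L N ht H⟩

/-! ## §4 Anisotropy is scale-invariant (EDITION 2) -/

/-- `⟪u, v⟫_{t • H} = t · ⟪u, v⟫_H` for the sesquilinear form ★ `hermForm` (Gram matrix scaled by `t`).
[cite: BergeronMillsonMoeglin2016Balls, Part 2 §1.1] -/
theorem hermForm_smul_gram {R : Type*} [CommRing R] {m : Type*} [Fintype m] (σ : R →+* R) (t : R)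
    (H : Matrix m m R) (u v : m → R) :
    Literature.AlgebraicGeometry.ShimuraVarieties.hermForm σ (t • H) u v =
      t * Literature.AlgebraicGeometry.ShimuraVarieties.hermForm σ H u v := by
  show (⇑σ ∘ u) ⬝ᵥ ((t • H) *ᵥ v) = t * ((⇑σ ∘ u) ⬝ᵥ (H *ᵥ v))
  rw [Matrix.smul_mulVec, dotProduct_smul, smul_eq_mul]

/-- **Anisotropy is scale-invariant**: for `t ≠ 0`, the hermitian form of `t • H` is anisotropic iff that of `H` is (the hypothesis of ★
`compactSpace_cmDatum_automorphicQuotient`, in its exact spelling, moves between `H` and `t • H`). [cite: PlatonovRapinchuk1994, §2.3] -/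
theorem anisotropic_smul_iff {t : L} (ht : t ≠ 0) (H : Matrix (Fin N) (Fin N) L) :
    (∀ x : Fin N → L, Literature.AlgebraicGeometry.ShimuraVarieties.hermForm (cmConjRingHom L) (t • H) x x = 0 → x = 0) ↔
      (∀ x : Fin N → L, Literature.AlgebraicGeometry.ShimuraVarieties.hermForm (cmConjRingHom L) H x x = 0 → x = 0) := by
  refine ⟨fun h x hx => h x ?_, fun h x hx => h x ?_⟩
  · rw [hermForm_smul_gram, hx, mul_zero]
  · rw [hermForm_smul_gram] at hx
    exact (mul_eq_zero.mp hx).resolve_left ht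

/-- `⟪v, w⟫_{ᵗ(σT)·D·T} = ⟪T v, T w⟫_D`: the form of a congruent Gram matrix (every index type; plumbing twin of the `Fin 2` lemma
★ `S1BettiSliceExclusion.hermForm_formCongr`). [folklore] -/
private theorem hermForm_formCongr' {R : Type*} [CommRing R] {m : Type*} [Fintype m] [DecidableEq m] (σ : R →+* R) (T : GL m R)
    (D : Matrix m m R) (v w : m → R) :
    Literature.AlgebraicGeometry.ShimuraVarieties.hermForm σ (formCongr σ T D) v w =
      Literature.AlgebraicGeometry.ShimuraVarieties.hermForm σ D ((T : Matrix m m R) *ᵥ v) ((T : Matrix m m R) *ᵥ w) := by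
  have h1 : (⇑σ ∘ ((T : Matrix m m R) *ᵥ v)) = ((T : Matrix m m R).map σ) *ᵥ (⇑σ ∘ v) :=
    funext fun i => RingHom.map_mulVec σ _ v i
  show (⇑σ ∘ v) ⬝ᵥ ((((T : Matrix m m R).map σ)ᵀ * D * (T : Matrix m m R)) *ᵥ w) =
    (⇑σ ∘ ((T : Matrix m m R) *ᵥ v)) ⬝ᵥ (D *ᵥ ((T : Matrix m m R) *ᵥ w))
  rw [h1, ← Matrix.mulVec_mulVec, ← Matrix.mulVec_mulVec, Matrix.dotProduct_mulVec (⇑σ ∘ v), Matrix.vecMul_transpose]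

open scoped ComplexOrder in
/-- **The ED. 11 rider — letters' frame ⇒ the engine's anisotropy hypothesis for `t • H`**: if `ᵗ(c g) · (t • H) · g = diagonal dV` and
`diagonal dV` is positive definite at SOME complex embedding `τ` (the curve* letters' definite place), then the hermitian form of `t • H` is
anisotropic: `t • H = ᵗ(c g⁻¹) · diagonal dV · g⁻¹` (★ `formCongr_inv_formCongr`), `⟪x, x⟫_{t • H} = ⟪g⁻¹ x, g⁻¹ x⟫_{diagonal dV}`, and `diagonal dV`
is anisotropic (★ `anisotropic_of_posDef_map`).  With `anisotropic_smul_iff` this also re-derives the `Fin 2` lemma ★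
`S1BettiSliceExclusion.anisotropic_of_formCongr_posDef` for `H` itself, at every `N`. [cite: PlatonovRapinchuk1994, §2.3] -/
theorem anisotropic_smul_of_formCongr_eq_of_posDef (H : Matrix (Fin N) (Fin N) L) (dV : Fin N → L) (t : L) (g : GL (Fin N) L)
    (hg : formCongr ((IsCMField.complexConj L : L ≃ₐ[↥(maximalRealSubfield L)] L) : L →+* L) g (t • H) = Matrix.diagonal dV)
    (τ : L →+* ℂ) (hτ : ((Matrix.diagonal dV).map τ).PosDef) :
    ∀ x : Fin N → L, Literature.AlgebraicGeometry.ShimuraVarieties.hermForm (cmConjRingHom L) (t • H) x x = 0 → x = 0 := by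
  intro x hx
  have hD := anisotropic_of_posDef_map L (Matrix.diagonal dV) τ hτ
  rw [ringHom_complexConj_eq_cmConjRingHom] at hg
  have hM : t • H = formCongr (cmConjRingHom L) g⁻¹ (Matrix.diagonal dV) := by
    rw [← hg, formCongr_inv_formCongr]
  have h2 : Literature.AlgebraicGeometry.ShimuraVarieties.hermForm (cmConjRingHom L) (Matrix.diagonal dV)
      (((g⁻¹ : GL (Fin N) L) : Matrix (Fin N) (Fin N) L) *ᵥ x) (((g⁻¹ : GL (Fin N) L) : Matrix (Fin N) (Fin N) L) *ᵥ x) = 0 := by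
    rw [← hermForm_formCongr', ← hM, hx]
  have h3 := hD _ h2
  have hx' : x = ((g : GL (Fin N) L) : Matrix (Fin N) (Fin N) L) *ᵥ ((((g⁻¹ : GL (Fin N) L) : Matrix (Fin N) (Fin N) L)) *ᵥ x) := by
    rw [Matrix.mulVec_mulVec, ← Units.val_mul, mul_inv_cancel, Units.val_one, Matrix.one_mulVec]
  rw [hx', h3, Matrix.mulVec_zero]

open scoped ComplexOrder in
/-- The same rider for `H` itself at every `N` (★ `S1BettiSliceExclusion.anisotropic_of_formCongr_posDef` is its `N = 2` case), by
`anisotropic_smul_iff`. [cite: PlatonovRapinchuk1994, §2.3] -/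
theorem anisotropic_of_formCongr_smul_eq_of_posDef (H : Matrix (Fin N) (Fin N) L) (dV : Fin N → L) (t : L) (ht : t ≠ 0)
    (g : GL (Fin N) L)
    (hg : formCongr ((IsCMField.complexConj L : L ≃ₐ[↥(maximalRealSubfield L)] L) : L →+* L) g (t • H) = Matrix.diagonal dV)
    (τ : L →+* ℂ) (hτ : ((Matrix.diagonal dV).map τ).PosDef) :
    ∀ x : Fin N → L, Literature.AlgebraicGeometry.ShimuraVarieties.hermForm (cmConjRingHom L) H x x = 0 → x = 0 :=
  (anisotropic_smul_iff L N ht H).mp (anisotropic_smul_of_formCongr_eq_of_posDef L N H dV t g hg τ hτ)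

end UnitaryGroup

end Literature.NumberTheory.Automorphic

end
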